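import Mathlib
import HarnessLib
import Summits.HubbardSuperconductivity.HubbardSuperconductivity.Theorems.KLProgrammeC4aFoldBoxPartnerBandPostLaws
import Summits.HubbardSuperconductivity.HubbardSuperconductivity.Theorems.KLProgrammeC4aPreCausticLevelLineDiagonal

/-!
# Route `KLProgramme` — crux C4a, S3 brick (B4) «(U1)-LAWS» part 4c: the TWO-SIDED and the POST-SIDE first-order laws for the partner band over ALL LOOP LEVELS
# `e ∈ [−hi, hi]` — the `lo`-free laws 4a/4b above and below the Fermi level at every floor `lo′ > 0`, carried to `lo′ = 0` by continuity of the primitive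

Cell `gate-hubbard-kl`, seat hubbard-kl-k3c3-p3 (g32; row «implicit-function / monotonicity route for μ(n)»).  Located brick for the (C)-closer lane / the (M4)
assembly of the umklapp first-order ϑ-layer (stub (C) `stub_twoLeg_curvature` of `KLRegimeEngineV17F2`, stmt-HubbardSuperconductivity-20437), memo
HOME/hubbard-kl-k3c3-p3/U1-CAUSTIC-SUP.md §12.

WHY.  The cover theorem's `hFlaw` / `hpost` hypotheses are ONE inequality each for one `F(ϑ)`, whose natural level range is the whole tube section `[−hi, hi]`.
Parts 4a/4b (`…C4aFoldBoxPartnerBandLaws`, `…PostLaws`) and their `_below` twins bound `∫_{lo..hi} w·|∫dv X·(K e)′(ē)| de` for levels `±e`, `e ∈ [lo,hi]`, by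
numbers that do NOT depend on `lo`; the kernel rows (`|K e u| ≤ 1/max(|e|,|u|)`, `|(K e)′u| ≤ 1/max(|e|,|u|)²`, `C¹`) are asked for every `0 < |e| ≤ hi` (true for the
pair kernel at every nonzero loop level; nothing is asked AT the Fermi level).  `…C4aPreCausticLevelLineDiagonal.intervalIntegral_le_of_forall_Ioc_left` carries the
uniform bound to the floor `0` on each side; the one extra input is the interval-integrability of the level layer on `[−hi,hi]` (continuity, for the closer's integrand).
* **`intervalIntegral_partnerBand_twoSided_lawShape_allLevels_le`**: `∫_{−hi..hi} w(e)·|∫_{α..β} X(e,v)·(K e)′(e_K(S − Φ(e,v+θ))) dv| de ≤ 2·A₁·((1 + log⁺(Γ/|δ₀|))²(1 + (√|δ₀|)⁻¹))`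
  (`A₁` = 4a's coefficient verbatim) — the `hFlaw` row of the cover theorem over all levels;
* **`intervalIntegral_partnerBand_post_allLevels_le`**: `… ≤ 2·P·(√|δ₀|)⁻¹` (`P` = 4b's coefficient verbatim) — the `hpost` row over all levels.
Sizes binder shape + `GeomConstants`; nothing asserts (C), K3 or superconductivity.
References: FST II CPAM 51 (1998) §3 [cite: FeldmanSalmhoferTrubowitz1998]; Salmhofer 1999 §4.5.3 [cite: Salmhofer1999].
-/

noncomputable section

namespace Summit.HubbardSuperconductivity.HubbardSuperconductivity.Theorems.C4a

set_option linter.dupNamespace false -- summit = problem name (single-conjunct summit), D-0017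

open Real Set MeasureTheory intervalIntegral
open Literature.MathematicalPhysics.QuantumLattice Literature.MathematicalPhysics.QuantumLattice.BandSectorCounting
open Literature.MathematicalPhysics.QuantumLattice.FermiRG
open Summit.HubbardSuperconductivity.HubbardSuperconductivity.Theorems.KLRegimeSplit
open Summit.HubbardSuperconductivity.HubbardSuperconductivity.Theorems.DispersionFlow
open Summit.HubbardSuperconductivity.HubbardSuperconductivity.Theorems.PerturbedFermiCurve

section Sizes

variable {K : TrigPolyC4v} {A : ℝ} (hA : ∀ p : Momentum, ∀ j ≤ 2, ‖iteratedFDeriv ℝ j (frameShift K) p‖ ≤ A) (hA20 : A ≤ 1 / 20)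
  (hd : klCurveD ≤ (bandBounds (show (-4 : ℝ) < -1.1 by norm_num) (show (-1.1 : ℝ) ≤ -0.1 by norm_num)
    (show (-0.1 : ℝ) < 0 by norm_num)).Dtmin - 2 * A)
  {μ r : ℝ} (hr : 0 < r) (hlo : (-1.1 : ℝ) < μ - r - A) (hhi : μ + r + A < -0.1)
  {A₃ A₄ : ℝ} (hA₃ : ∀ p : Momentum, ‖iteratedFDeriv ℝ 3 (frameShift K) p‖ ≤ A₃)
  (hA₄ : ∀ p : Momentum, ‖iteratedFDeriv ℝ 4 (frameShift K) p‖ ≤ A₄)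
  {K₁ K₂ K₃ : ℝ} (hK₁ : ∀ p : Momentum, ‖fderiv ℝ (frameLevel μ K) p‖ ≤ K₁) (hK₂ : ∀ p : Momentum, ‖iteratedFDeriv ℝ 2 (frameLevel μ K) p‖ ≤ K₂)
  (hK₃ : ∀ p : Momentum, ‖iteratedFDeriv ℝ 3 (frameLevel μ K) p‖ ≤ K₃)
include hA hA20 hd hr hlo hhi hA₃ hA₄ hK₁ hK₂ hK₃

set_option maxHeartbeats 400000 in
/-- **THE TWO-SIDED FIRST-ORDER LAW FOR THE PARTNER BAND OVER ALL LOOP LEVELS** (`hFlaw` currency; see the module docstring). -/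
theorem intervalIntegral_partnerBand_twoSided_lawShape_allLevels_le {Kc r₀ g₀ w : ℝ} (hG : GeomConstants (frameLevel μ K) Kc r₀ g₀ w) (S : Momentum) (m : Fin 2 → ℤ)
    (θ : ℝ) {α β x₀ Wm Wφ hi K₀ X₀ X₁ W Γ : ℝ} {X Kr : ℝ → ℝ → ℝ} {wt : ℝ → ℝ}
    (hx₀ : x₀ ∈ Icc α β) (hWα : Wm ≤ x₀ - α) (hWβ : Wm ≤ β - x₀) (hWφ : ∀ y ∈ Icc α β, |y - x₀| ≤ Wφ)
    (hhi0 : 0 < hi) (hhir : hi < r) (hK₀ : ∀ p : Momentum, |frameLevel μ K p| ≤ K₀) (hK₀pos : 0 < K₀) (hX₀ : 0 ≤ X₀) (hX₁ : 0 ≤ X₁)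
    (hW : 0 ≤ W) (hΓ₁ : K₀ ≤ Γ) (hΓ₂ : hi / 2 ≤ Γ)
    (hδ₀ : 0 < |sInf ((fun x : ℝ => frameLevel μ K (S - levelPoint μ K 0 (x + θ))) '' Icc α β)|)
    (hwin : ∀ e ∈ Icc (-hi) hi, ∀ y ∈ Icc α β,
      K₃ * (‖S - WithLp.toLp 2 (fun i => 2 * π * (m i : ℝ)) - (levelPoint μ K 0 (x₀ + θ) + levelPoint μ K 0 (x₀ + θ))‖ +
              |e| / ((bandBounds (show (-4 : ℝ) < -1.1 by norm_num) (show (-1.1 : ℝ) ≤ -0.1 by norm_num) (show (-0.1 : ℝ) < 0 by norm_num)).Dtmin - 2 * A) +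
              msD A₃ A₄ 1 * |y - x₀|) * msD A₃ A₄ 1 ^ 2 +
          K₂ * (radialRowOneConst A ((bandBounds (show (-4 : ℝ) < -1.1 by norm_num) (show (-1.1 : ℝ) ≤ -0.1 by norm_num) (show (-0.1 : ℝ) < 0 by norm_num)).Dtmin -
                2 * A) * |e| + msD A₃ A₄ 2 * |y - x₀|) * (msD A₃ A₄ 1 + msD A₃ A₄ 1) +
          K₂ * (‖S - WithLp.toLp 2 (fun i => 2 * π * (m i : ℝ)) - (levelPoint μ K 0 (x₀ + θ) + levelPoint μ K 0 (x₀ + θ))‖ +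
              |e| / ((bandBounds (show (-4 : ℝ) < -1.1 by norm_num) (show (-1.1 : ℝ) ≤ -0.1 by norm_num) (show (-0.1 : ℝ) < 0 by norm_num)).Dtmin - 2 * A) +
              msD A₃ A₄ 1 * |y - x₀|) * msD A₃ A₄ 2 +
          K₁ * ((uRowTwoConst A A₃ ((bandBounds (show (-4 : ℝ) < -1.1 by norm_num) (show (-1.1 : ℝ) ≤ -0.1 by norm_num) (show (-0.1 : ℝ) < 0 by norm_num)).Dtmin -
                  2 * A) +
                1 / ((bandBounds (show (-4 : ℝ) < -1.1 by norm_num) (show (-1.1 : ℝ) ≤ -0.1 by norm_num) (show (-0.1 : ℝ) < 0 by norm_num)).Dtmin - 2 * A) +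
                2 * (radialRowOneConst A ((bandBounds (show (-4 : ℝ) < -1.1 by norm_num) (show (-1.1 : ℝ) ≤ -0.1 by norm_num)
                    (show (-0.1 : ℝ) < 0 by norm_num)).Dtmin - 2 * A) -
                  1 / ((bandBounds (show (-4 : ℝ) < -1.1 by norm_num) (show (-1.1 : ℝ) ≤ -0.1 by norm_num) (show (-0.1 : ℝ) < 0 by norm_num)).Dtmin - 2 * A))) *
              |e| + msD A₃ A₄ 3 * |y - x₀|) ≤
        w * (bandBounds (show (-4 : ℝ) < -1.1 by norm_num) (show (-1.1 : ℝ) ≤ -0.1 by norm_num) (show (-0.1 : ℝ) < 0 by norm_num)).umin ^ 2)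
    (hslope : K₂ * msD A₃ A₄ 1 * (‖S - WithLp.toLp 2 (fun i => 2 * π * (m i : ℝ)) - (2 : ℝ) • levelPoint μ K 0 (x₀ + θ)‖ +
        2 * (hi / ((bandBounds (show (-4 : ℝ) < -1.1 by norm_num) (show (-1.1 : ℝ) ≤ -0.1 by norm_num) (show (-0.1 : ℝ) < 0 by norm_num)).Dtmin - 2 * A))) ≤
      w * (bandBounds (show (-4 : ℝ) < -1.1 by norm_num) (show (-1.1 : ℝ) ≤ -0.1 by norm_num) (show (-0.1 : ℝ) < 0 by norm_num)).umin ^ 2 * Wm)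
    (hrate : K₂ * (‖S - WithLp.toLp 2 (fun i => 2 * π * (m i : ℝ)) - (2 : ℝ) • levelPoint μ K 0 (x₀ + θ)‖ +
          2 * (hi / ((bandBounds (show (-4 : ℝ) < -1.1 by norm_num) (show (-1.1 : ℝ) ≤ -0.1 by norm_num) (show (-0.1 : ℝ) < 0 by norm_num)).Dtmin - 2 * A) +
            msD A₃ A₄ 1 * Wφ)) /
        ((bandBounds (show (-4 : ℝ) < -1.1 by norm_num) (show (-1.1 : ℝ) ≤ -0.1 by norm_num) (show (-0.1 : ℝ) < 0 by norm_num)).Dtmin - 2 * A) ≤ 1 / 2)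
    (hK : ∀ e ∈ Icc (-hi) hi, e ≠ 0 → ContDiff ℝ 1 (Kr e)) (hK0 : ∀ e ∈ Icc (-hi) hi, e ≠ 0 → ∀ u, |Kr e u| ≤ (max |e| |u|)⁻¹)
    (hK1 : ∀ e ∈ Icc (-hi) hi, e ≠ 0 → ∀ u, |deriv (Kr e) u| ≤ (max |e| |u|)⁻¹ ^ 2)
    (hX : ∀ e ∈ Icc (-hi) hi, ContDiff ℝ 1 (X e)) (hXb : ∀ e ∈ Icc (-hi) hi, ∀ v ∈ Icc α β, |X e v| ≤ X₀)
    (hX₁b : ∀ e ∈ Icc (-hi) hi, ∀ v ∈ Icc α β, |deriv (X e) v| ≤ X₁) (hXα : ∀ e ∈ Icc (-hi) hi, X e α = 0) (hXβ : ∀ e ∈ Icc (-hi) hi, X e β = 0)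
    (hw0 : ∀ e ∈ Icc (-hi) hi, 0 ≤ wt e) (hw : ∀ e ∈ Icc (-hi) hi, wt e ≤ W)
    (hgi : IntervalIntegrable (fun e => wt e * |∫ v in α..β, X e v * deriv (Kr e) (frameLevel μ K (S - levelPoint μ K e (v + θ)))|) volume (-hi) hi) :
    ∫ e in (-hi)..hi, wt e * |∫ v in α..β, X e v * deriv (Kr e) (frameLevel μ K (S - levelPoint μ K e (v + θ)))| ≤
      2 * (3 * W * ((4 + 2 * (3 / 2 : ℝ) + 1 / 2) / (1 / 2)) *
          (X₀ * (4 / Real.sqrt (2 * (K₂ * msD A₃ A₄ 1 ^ 2) +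
                    w * (bandBounds (show (-4 : ℝ) < -1.1 by norm_num) (show (-1.1 : ℝ) ≤ -0.1 by norm_num) (show (-0.1 : ℝ) < 0 by norm_num)).umin ^ 2) +
                  16 * Real.sqrt (2 * (K₂ * msD A₃ A₄ 1 ^ 2) +
                        w * (bandBounds (show (-4 : ℝ) < -1.1 by norm_num) (show (-1.1 : ℝ) ≤ -0.1 by norm_num) (show (-0.1 : ℝ) < 0 by norm_num)).umin ^ 2) /
                      (w * (bandBounds (show (-4 : ℝ) < -1.1 by norm_num) (show (-1.1 : ℝ) ≤ -0.1 by norm_num) (show (-0.1 : ℝ) < 0 by norm_num)).umin ^ 2) +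
                  64 * (2 * (K₂ * msD A₃ A₄ 1 ^ 2) +
                          w * (bandBounds (show (-4 : ℝ) < -1.1 by norm_num) (show (-1.1 : ℝ) ≤ -0.1 by norm_num) (show (-0.1 : ℝ) < 0 by norm_num)).umin ^ 2) ^ 2 *
                      Real.sqrt (2 * (K₂ * msD A₃ A₄ 1 ^ 2) +
                          w * (bandBounds (show (-4 : ℝ) < -1.1 by norm_num) (show (-1.1 : ℝ) ≤ -0.1 by norm_num) (show (-0.1 : ℝ) < 0 by norm_num)).umin ^ 2) /
                    (w * (bandBounds (show (-4 : ℝ) < -1.1 by norm_num) (show (-1.1 : ℝ) ≤ -0.1 by norm_num) (show (-0.1 : ℝ) < 0 by norm_num)).umin ^ 2) ^ 3) *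
              Real.sqrt (4 + 2 * (3 / 2 : ℝ) + 1 / 2) +
            32 * X₁ * (2 * (K₂ * msD A₃ A₄ 1 ^ 2) +
                  w * (bandBounds (show (-4 : ℝ) < -1.1 by norm_num) (show (-1.1 : ℝ) ≤ -0.1 by norm_num) (show (-0.1 : ℝ) < 0 by norm_num)).umin ^ 2) /
              (w * (bandBounds (show (-4 : ℝ) < -1.1 by norm_num) (show (-1.1 : ℝ) ≤ -0.1 by norm_num) (show (-0.1 : ℝ) < 0 by norm_num)).umin ^ 2) ^ 2) *
        ((1 + log⁺ (Γ / |sInf ((fun x : ℝ => frameLevel μ K (S - levelPoint μ K 0 (x + θ))) '' Icc α β)|)) ^ 2 *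
          (1 + (Real.sqrt |sInf ((fun x : ℝ => frameLevel μ K (S - levelPoint μ K 0 (x + θ))) '' Icc α β)|)⁻¹))) := by
  have hhir' : -r < -hi := by linarith
  -- the four families of rows restricted to a positive floor `lo' > 0`, above and below the Fermi level
  have habs : ∀ {lo' e : ℝ}, 0 < lo' → e ∈ Icc lo' hi → |e| = e := fun hlo' he => abs_of_pos (hlo'.trans_le he.1)
  have hmem : ∀ {lo' e : ℝ}, 0 < lo' → e ∈ Icc lo' hi → e ∈ Icc (-hi) hi ∧ e ≠ 0 := fun hlo' he =>
    ⟨⟨by linarith [he.1], he.2⟩, (hlo'.trans_le he.1).ne'⟩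
  have hmemn : ∀ {lo' s : ℝ}, 0 < lo' → s ∈ Icc lo' hi → -s ∈ Icc (-hi) hi ∧ -s ≠ 0 := fun hlo' hs =>
    ⟨⟨by linarith [hs.2], by linarith [hs.1]⟩, by have := hlo'.trans_le hs.1; intro h; linarith⟩
  have habsn : ∀ {lo' s : ℝ}, 0 < lo' → s ∈ Icc lo' hi → |(-s)| = s := fun hlo' hs => by rw [abs_neg]; exact abs_of_pos (hlo'.trans_le hs.1)
  -- above the Fermi level, every floor
  have hpos : ∀ lo' ∈ Ioc 0 hi, ∫ e in lo'..hi, wt e * |∫ v in α..β, X e v * deriv (Kr e) (frameLevel μ K (S - levelPoint μ K e (v + θ)))| ≤ 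
      3 * W * ((4 + 2 * (3 / 2 : ℝ) + 1 / 2) / (1 / 2)) *
          (X₀ * (4 / Real.sqrt (2 * (K₂ * msD A₃ A₄ 1 ^ 2) +
                    w * (bandBounds (show (-4 : ℝ) < -1.1 by norm_num) (show (-1.1 : ℝ) ≤ -0.1 by norm_num) (show (-0.1 : ℝ) < 0 by norm_num)).umin ^ 2) +
                  16 * Real.sqrt (2 * (K₂ * msD A₃ A₄ 1 ^ 2) +
                        w * (bandBounds (show (-4 : ℝ) < -1.1 by norm_num) (show (-1.1 : ℝ) ≤ -0.1 by norm_num) (show (-0.1 : ℝ) < 0 by norm_num)).umin ^ 2) /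
                      (w * (bandBounds (show (-4 : ℝ) < -1.1 by norm_num) (show (-1.1 : ℝ) ≤ -0.1 by norm_num) (show (-0.1 : ℝ) < 0 by norm_num)).umin ^ 2) +
                  64 * (2 * (K₂ * msD A₃ A₄ 1 ^ 2) +
                          w * (bandBounds (show (-4 : ℝ) < -1.1 by norm_num) (show (-1.1 : ℝ) ≤ -0.1 by norm_num) (show (-0.1 : ℝ) < 0 by norm_num)).umin ^ 2) ^ 2 *
                      Real.sqrt (2 * (K₂ * msD A₃ A₄ 1 ^ 2) +
                          w * (bandBounds (show (-4 : ℝ) < -1.1 by norm_num) (show (-1.1 : ℝ) ≤ -0.1 by norm_num) (show (-0.1 : ℝ) < 0 by norm_num)).umin ^ 2) /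
                    (w * (bandBounds (show (-4 : ℝ) < -1.1 by norm_num) (show (-1.1 : ℝ) ≤ -0.1 by norm_num) (show (-0.1 : ℝ) < 0 by norm_num)).umin ^ 2) ^ 3) *
              Real.sqrt (4 + 2 * (3 / 2 : ℝ) + 1 / 2) +
            32 * X₁ * (2 * (K₂ * msD A₃ A₄ 1 ^ 2) +
                  w * (bandBounds (show (-4 : ℝ) < -1.1 by norm_num) (show (-1.1 : ℝ) ≤ -0.1 by norm_num) (show (-0.1 : ℝ) < 0 by norm_num)).umin ^ 2) /
              (w * (bandBounds (show (-4 : ℝ) < -1.1 by norm_num) (show (-1.1 : ℝ) ≤ -0.1 by norm_num) (show (-0.1 : ℝ) < 0 by norm_num)).umin ^ 2) ^ 2) *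
        ((1 + log⁺ (Γ / |sInf ((fun x : ℝ => frameLevel μ K (S - levelPoint μ K 0 (x + θ))) '' Icc α β)|)) ^ 2 *
          (1 + (Real.sqrt |sInf ((fun x : ℝ => frameLevel μ K (S - levelPoint μ K 0 (x + θ))) '' Icc α β)|)⁻¹)) := by
    intro lo' hlo'
    exact intervalIntegral_partnerBand_twoSided_lawShape_le hA hA20 hd hr hlo hhi hA₃ hA₄ hK₁ hK₂ hK₃ hG S m θ hx₀ hWα hWβ hWφ hlo'.1 hlo'.2 hhir hK₀ hK₀pos hX₀ hX₁ hW hΓ₁ hΓ₂ hδ₀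
      hwin hslope hrate
      (fun e he => hK e (hmem hlo'.1 he).1 (hmem hlo'.1 he).2)
      (fun e he u => by have h := hK0 e (hmem hlo'.1 he).1 (hmem hlo'.1 he).2 u; rwa [habs hlo'.1 he] at h)
      (fun e he u => by have h := hK1 e (hmem hlo'.1 he).1 (hmem hlo'.1 he).2 u; rwa [habs hlo'.1 he] at h)
      (fun e he => hX e (hmem hlo'.1 he).1) (fun e he v hv => hXb e (hmem hlo'.1 he).1 v hv) (fun e he v hv => hX₁b e (hmem hlo'.1 he).1 v hv)
      (fun e he => hXα e (hmem hlo'.1 he).1) (fun e he => hXβ e (hmem hlo'.1 he).1) (fun e he => hw0 e (hmem hlo'.1 he).1) (fun e he => hw e (hmem hlo'.1 he).1)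
  -- below the Fermi level, every floor (the reflected families)
  have hneg : ∀ lo' ∈ Ioc 0 hi, ∫ s in lo'..hi, wt (-s) * |∫ v in α..β, X (-s) v * deriv (Kr (-s)) (frameLevel μ K (S - levelPoint μ K (-s) (v + θ)))| ≤ 
      3 * W * ((4 + 2 * (3 / 2 : ℝ) + 1 / 2) / (1 / 2)) *
          (X₀ * (4 / Real.sqrt (2 * (K₂ * msD A₃ A₄ 1 ^ 2) +
                    w * (bandBounds (show (-4 : ℝ) < -1.1 by norm_num) (show (-1.1 : ℝ) ≤ -0.1 by norm_num) (show (-0.1 : ℝ) < 0 by norm_num)).umin ^ 2) +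
                  16 * Real.sqrt (2 * (K₂ * msD A₃ A₄ 1 ^ 2) +
                        w * (bandBounds (show (-4 : ℝ) < -1.1 by norm_num) (show (-1.1 : ℝ) ≤ -0.1 by norm_num) (show (-0.1 : ℝ) < 0 by norm_num)).umin ^ 2) /
                      (w * (bandBounds (show (-4 : ℝ) < -1.1 by norm_num) (show (-1.1 : ℝ) ≤ -0.1 by norm_num) (show (-0.1 : ℝ) < 0 by norm_num)).umin ^ 2) +
                  64 * (2 * (K₂ * msD A₃ A₄ 1 ^ 2) +
                          w * (bandBounds (show (-4 : ℝ) < -1.1 by norm_num) (show (-1.1 : ℝ) ≤ -0.1 by norm_num) (show (-0.1 : ℝ) < 0 by norm_num)).umin ^ 2) ^ 2 *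
                      Real.sqrt (2 * (K₂ * msD A₃ A₄ 1 ^ 2) +
                          w * (bandBounds (show (-4 : ℝ) < -1.1 by norm_num) (show (-1.1 : ℝ) ≤ -0.1 by norm_num) (show (-0.1 : ℝ) < 0 by norm_num)).umin ^ 2) /
                    (w * (bandBounds (show (-4 : ℝ) < -1.1 by norm_num) (show (-1.1 : ℝ) ≤ -0.1 by norm_num) (show (-0.1 : ℝ) < 0 by norm_num)).umin ^ 2) ^ 3) *
              Real.sqrt (4 + 2 * (3 / 2 : ℝ) + 1 / 2) +
            32 * X₁ * (2 * (K₂ * msD A₃ A₄ 1 ^ 2) +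
                  w * (bandBounds (show (-4 : ℝ) < -1.1 by norm_num) (show (-1.1 : ℝ) ≤ -0.1 by norm_num) (show (-0.1 : ℝ) < 0 by norm_num)).umin ^ 2) /
              (w * (bandBounds (show (-4 : ℝ) < -1.1 by norm_num) (show (-1.1 : ℝ) ≤ -0.1 by norm_num) (show (-0.1 : ℝ) < 0 by norm_num)).umin ^ 2) ^ 2) *
        ((1 + log⁺ (Γ / |sInf ((fun x : ℝ => frameLevel μ K (S - levelPoint μ K 0 (x + θ))) '' Icc α β)|)) ^ 2 *
          (1 + (Real.sqrt |sInf ((fun x : ℝ => frameLevel μ K (S - levelPoint μ K 0 (x + θ))) '' Icc α β)|)⁻¹)) := by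
    intro lo' hlo'
    exact intervalIntegral_partnerBand_twoSided_lawShape_below_le hA hA20 hd hr hlo hhi hA₃ hA₄ hK₁ hK₂ hK₃ hG S m θ (X := fun s => X (-s)) (Kr := fun s => Kr (-s)) (wt := fun s => wt (-s))
      hx₀ hWα hWβ hWφ hlo'.1 hlo'.2 hhir hK₀ hK₀pos hX₀ hX₁ hW hΓ₁ hΓ₂ hδ₀
      hwin hslope hrate
      (fun s hs => hK (-s) (hmemn hlo'.1 hs).1 (hmemn hlo'.1 hs).2)
      (fun s hs u => by have h := hK0 (-s) (hmemn hlo'.1 hs).1 (hmemn hlo'.1 hs).2 u; rwa [habsn hlo'.1 hs] at h)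
      (fun s hs u => by have h := hK1 (-s) (hmemn hlo'.1 hs).1 (hmemn hlo'.1 hs).2 u; rwa [habsn hlo'.1 hs] at h)
      (fun s hs => hX (-s) (hmemn hlo'.1 hs).1) (fun s hs v hv => hXb (-s) (hmemn hlo'.1 hs).1 v hv) (fun s hs v hv => hX₁b (-s) (hmemn hlo'.1 hs).1 v hv)
      (fun s hs => hXα (-s) (hmemn hlo'.1 hs).1) (fun s hs => hXβ (-s) (hmemn hlo'.1 hs).1) (fun s hs => hw0 (-s) (hmemn hlo'.1 hs).1)
      (fun s hs => hw (-s) (hmemn hlo'.1 hs).1)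
  -- pass to the Fermi level on both sides
  have hgiP : IntervalIntegrable (fun e => wt e * |∫ v in α..β, X e v * deriv (Kr e) (frameLevel μ K (S - levelPoint μ K e (v + θ)))|) volume 0 hi :=
    hgi.mono_set (by rw [uIcc_of_le (by linarith : -hi ≤ hi), uIcc_of_le hhi0.le]; exact Icc_subset_Icc (by linarith) le_rfl)
  have hgiN : IntervalIntegrable (fun e => wt e * |∫ v in α..β, X e v * deriv (Kr e) (frameLevel μ K (S - levelPoint μ K e (v + θ)))|) volume (-hi) 0 :=
    hgi.mono_set (by rw [uIcc_of_le (by linarith : -hi ≤ hi), uIcc_of_le (by linarith : -hi ≤ 0)]; exact Icc_subset_Icc le_rfl hhi0.le)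
  have hgiNr : IntervalIntegrable (fun s => wt (-s) * |∫ v in α..β, X (-s) v * deriv (Kr (-s)) (frameLevel μ K (S - levelPoint μ K (-s) (v + θ)))|) volume 0 hi := by
    have h := hgiN.comp_sub_left 0
    simp only [zero_sub, sub_zero, neg_neg] at h
    exact h.symm
  have hfwd := intervalIntegral_le_of_forall_Ioc_left hhi0 le_rfl hgiP hpos
  have hbwd := intervalIntegral_le_of_forall_Ioc_left hhi0 le_rfl hgiNr hneg
  have hsplit : ∫ e in (-hi)..hi, wt e * |∫ v in α..β, X e v * deriv (Kr e) (frameLevel μ K (S - levelPoint μ K e (v + θ)))| =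
      (∫ s in (0:ℝ)..hi, wt (-s) * |∫ v in α..β, X (-s) v * deriv (Kr (-s)) (frameLevel μ K (S - levelPoint μ K (-s) (v + θ)))|) +
        ∫ e in (0:ℝ)..hi, wt e * |∫ v in α..β, X e v * deriv (Kr e) (frameLevel μ K (S - levelPoint μ K e (v + θ)))| := by
    rw [← intervalIntegral.integral_add_adjacent_intervals hgiN hgiP]
    rw [intervalIntegral.integral_comp_neg (fun e => wt e * |∫ v in α..β, X e v * deriv (Kr e) (frameLevel μ K (S - levelPoint μ K e (v + θ)))|)]
    simp
  rw [hsplit]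
  linarith

set_option maxHeartbeats 400000 in
/-- **THE LOG-FREE (POST-SIDE) FIRST-ORDER LAW FOR THE PARTNER BAND OVER ALL LOOP LEVELS** (`hpost` currency; see the module docstring). -/
theorem intervalIntegral_partnerBand_post_allLevels_le {Kc r₀ g₀ w : ℝ} (hG : GeomConstants (frameLevel μ K) Kc r₀ g₀ w) (S : Momentum) (m : Fin 2 → ℤ)
    (θ : ℝ) {α β x₀ Wm Wφ hi K₀ X₀ X₁ W : ℝ} {X Kr : ℝ → ℝ → ℝ} {wt : ℝ → ℝ}
    (hx₀ : x₀ ∈ Icc α β) (hWα : Wm ≤ x₀ - α) (hWβ : Wm ≤ β - x₀) (hWφ : ∀ y ∈ Icc α β, |y - x₀| ≤ Wφ)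
    (hhi0 : 0 < hi) (hhir : hi < r) (hK₀ : ∀ p : Momentum, |frameLevel μ K p| ≤ K₀) (hK₀pos : 0 < K₀) (hX₀ : 0 ≤ X₀) (hX₁ : 0 ≤ X₁)
    (hW : 0 ≤ W)
    (hδ₀ : 0 < |sInf ((fun x : ℝ => frameLevel μ K (S - levelPoint μ K 0 (x + θ))) '' Icc α β)|)
    (hwin : ∀ e ∈ Icc (-hi) hi, ∀ y ∈ Icc α β,
      K₃ * (‖S - WithLp.toLp 2 (fun i => 2 * π * (m i : ℝ)) - (levelPoint μ K 0 (x₀ + θ) + levelPoint μ K 0 (x₀ + θ))‖ +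
              |e| / ((bandBounds (show (-4 : ℝ) < -1.1 by norm_num) (show (-1.1 : ℝ) ≤ -0.1 by norm_num) (show (-0.1 : ℝ) < 0 by norm_num)).Dtmin - 2 * A) +
              msD A₃ A₄ 1 * |y - x₀|) * msD A₃ A₄ 1 ^ 2 +
          K₂ * (radialRowOneConst A ((bandBounds (show (-4 : ℝ) < -1.1 by norm_num) (show (-1.1 : ℝ) ≤ -0.1 by norm_num) (show (-0.1 : ℝ) < 0 by norm_num)).Dtmin -
                2 * A) * |e| + msD A₃ A₄ 2 * |y - x₀|) * (msD A₃ A₄ 1 + msD A₃ A₄ 1) +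
          K₂ * (‖S - WithLp.toLp 2 (fun i => 2 * π * (m i : ℝ)) - (levelPoint μ K 0 (x₀ + θ) + levelPoint μ K 0 (x₀ + θ))‖ +
              |e| / ((bandBounds (show (-4 : ℝ) < -1.1 by norm_num) (show (-1.1 : ℝ) ≤ -0.1 by norm_num) (show (-0.1 : ℝ) < 0 by norm_num)).Dtmin - 2 * A) +
              msD A₃ A₄ 1 * |y - x₀|) * msD A₃ A₄ 2 +
          K₁ * ((uRowTwoConst A A₃ ((bandBounds (show (-4 : ℝ) < -1.1 by norm_num) (show (-1.1 : ℝ) ≤ -0.1 by norm_num) (show (-0.1 : ℝ) < 0 by norm_num)).Dtmin -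
                  2 * A) +
                1 / ((bandBounds (show (-4 : ℝ) < -1.1 by norm_num) (show (-1.1 : ℝ) ≤ -0.1 by norm_num) (show (-0.1 : ℝ) < 0 by norm_num)).Dtmin - 2 * A) +
                2 * (radialRowOneConst A ((bandBounds (show (-4 : ℝ) < -1.1 by norm_num) (show (-1.1 : ℝ) ≤ -0.1 by norm_num)
                    (show (-0.1 : ℝ) < 0 by norm_num)).Dtmin - 2 * A) -
                  1 / ((bandBounds (show (-4 : ℝ) < -1.1 by norm_num) (show (-1.1 : ℝ) ≤ -0.1 by norm_num) (show (-0.1 : ℝ) < 0 by norm_num)).Dtmin - 2 * A))) *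
              |e| + msD A₃ A₄ 3 * |y - x₀|) ≤
        w * (bandBounds (show (-4 : ℝ) < -1.1 by norm_num) (show (-1.1 : ℝ) ≤ -0.1 by norm_num) (show (-0.1 : ℝ) < 0 by norm_num)).umin ^ 2)
    (hslope : K₂ * msD A₃ A₄ 1 * (‖S - WithLp.toLp 2 (fun i => 2 * π * (m i : ℝ)) - (2 : ℝ) • levelPoint μ K 0 (x₀ + θ)‖ +
        2 * (hi / ((bandBounds (show (-4 : ℝ) < -1.1 by norm_num) (show (-1.1 : ℝ) ≤ -0.1 by norm_num) (show (-0.1 : ℝ) < 0 by norm_num)).Dtmin - 2 * A))) ≤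
      w * (bandBounds (show (-4 : ℝ) < -1.1 by norm_num) (show (-1.1 : ℝ) ≤ -0.1 by norm_num) (show (-0.1 : ℝ) < 0 by norm_num)).umin ^ 2 * Wm)
    (hrate : K₂ * (‖S - WithLp.toLp 2 (fun i => 2 * π * (m i : ℝ)) - (2 : ℝ) • levelPoint μ K 0 (x₀ + θ)‖ +
          2 * (hi / ((bandBounds (show (-4 : ℝ) < -1.1 by norm_num) (show (-1.1 : ℝ) ≤ -0.1 by norm_num) (show (-0.1 : ℝ) < 0 by norm_num)).Dtmin - 2 * A) +
            msD A₃ A₄ 1 * Wφ)) /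
        ((bandBounds (show (-4 : ℝ) < -1.1 by norm_num) (show (-1.1 : ℝ) ≤ -0.1 by norm_num) (show (-0.1 : ℝ) < 0 by norm_num)).Dtmin - 2 * A) ≤ 1 / 2)
    (hK : ∀ e ∈ Icc (-hi) hi, e ≠ 0 → ContDiff ℝ 1 (Kr e)) (hK0 : ∀ e ∈ Icc (-hi) hi, e ≠ 0 → ∀ u, |Kr e u| ≤ (max |e| |u|)⁻¹)
    (hK1 : ∀ e ∈ Icc (-hi) hi, e ≠ 0 → ∀ u, |deriv (Kr e) u| ≤ (max |e| |u|)⁻¹ ^ 2)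
    (hX : ∀ e ∈ Icc (-hi) hi, ContDiff ℝ 1 (X e)) (hXb : ∀ e ∈ Icc (-hi) hi, ∀ v ∈ Icc α β, |X e v| ≤ X₀)
    (hX₁b : ∀ e ∈ Icc (-hi) hi, ∀ v ∈ Icc α β, |deriv (X e) v| ≤ X₁) (hXα : ∀ e ∈ Icc (-hi) hi, X e α = 0) (hXβ : ∀ e ∈ Icc (-hi) hi, X e β = 0)
    (hw0 : ∀ e ∈ Icc (-hi) hi, 0 ≤ wt e) (hw : ∀ e ∈ Icc (-hi) hi, wt e ≤ W)
    (hgi : IntervalIntegrable (fun e => wt e * |∫ v in α..β, X e v * deriv (Kr e) (frameLevel μ K (S - levelPoint μ K e (v + θ)))|) volume (-hi) hi) :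
    ∫ e in (-hi)..hi, wt e * |∫ v in α..β, X e v * deriv (Kr e) (frameLevel μ K (S - levelPoint μ K e (v + θ)))| ≤
      2 * (W * (X₀ * (4 / Real.sqrt (2 * (K₂ * msD A₃ A₄ 1 ^ 2) +
                    w * (bandBounds (show (-4 : ℝ) < -1.1 by norm_num) (show (-1.1 : ℝ) ≤ -0.1 by norm_num) (show (-0.1 : ℝ) < 0 by norm_num)).umin ^ 2) + 16 * Real.sqrt (2 * (K₂ * msD A₃ A₄ 1 ^ 2) +
                    w * (bandBounds (show (-4 : ℝ) < -1.1 by norm_num) (show (-1.1 : ℝ) ≤ -0.1 by norm_num) (show (-0.1 : ℝ) < 0 by norm_num)).umin ^ 2) / (w * (bandBounds (show (-4 : ℝ) < -1.1 by norm_num) (show (-1.1 : ℝ) ≤ -0.1 by norm_num) (show (-0.1 : ℝ) < 0 by norm_num)).umin ^ 2) + 64 * (2 * (K₂ * msD A₃ A₄ 1 ^ 2) +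
                    w * (bandBounds (show (-4 : ℝ) < -1.1 by norm_num) (show (-1.1 : ℝ) ≤ -0.1 by norm_num) (show (-0.1 : ℝ) < 0 by norm_num)).umin ^ 2) ^ 2 * Real.sqrt (2 * (K₂ * msD A₃ A₄ 1 ^ 2) +
                    w * (bandBounds (show (-4 : ℝ) < -1.1 by norm_num) (show (-1.1 : ℝ) ≤ -0.1 by norm_num) (show (-0.1 : ℝ) < 0 by norm_num)).umin ^ 2) / (w * (bandBounds (show (-4 : ℝ) < -1.1 by norm_num) (show (-1.1 : ℝ) ≤ -0.1 by norm_num) (show (-0.1 : ℝ) < 0 by norm_num)).umin ^ 2) ^ 3 +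
              2 * Real.sqrt (w * (bandBounds (show (-4 : ℝ) < -1.1 by norm_num) (show (-1.1 : ℝ) ≤ -0.1 by norm_num) (show (-0.1 : ℝ) < 0 by norm_num)).umin ^ 2) / (w * (bandBounds (show (-4 : ℝ) < -1.1 by norm_num) (show (-1.1 : ℝ) ≤ -0.1 by norm_num) (show (-0.1 : ℝ) < 0 by norm_num)).umin ^ 2) + (2 * (K₂ * msD A₃ A₄ 1 ^ 2) +
                    w * (bandBounds (show (-4 : ℝ) < -1.1 by norm_num) (show (-1.1 : ℝ) ≤ -0.1 by norm_num) (show (-0.1 : ℝ) < 0 by norm_num)).umin ^ 2) * Real.sqrt (w * (bandBounds (show (-4 : ℝ) < -1.1 by norm_num) (show (-1.1 : ℝ) ≤ -0.1 by norm_num) (show (-0.1 : ℝ) < 0 by norm_num)).umin ^ 2) / (w * (bandBounds (show (-4 : ℝ) < -1.1 by norm_num) (show (-1.1 : ℝ) ≤ -0.1 by norm_num) (show (-0.1 : ℝ) < 0 by norm_num)).umin ^ 2) ^ 2) +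
            X₁ * (32 * (2 * (K₂ * msD A₃ A₄ 1 ^ 2) +
                    w * (bandBounds (show (-4 : ℝ) < -1.1 by norm_num) (show (-1.1 : ℝ) ≤ -0.1 by norm_num) (show (-0.1 : ℝ) < 0 by norm_num)).umin ^ 2) * Real.sqrt (K₀ + hi) / (w * (bandBounds (show (-4 : ℝ) < -1.1 by norm_num) (show (-1.1 : ℝ) ≤ -0.1 by norm_num) (show (-0.1 : ℝ) < 0 by norm_num)).umin ^ 2) ^ 2 + (β - α) * Real.sqrt (w * (bandBounds (show (-4 : ℝ) < -1.1 by norm_num) (show (-1.1 : ℝ) ≤ -0.1 by norm_num) (show (-0.1 : ℝ) < 0 by norm_num)).umin ^ 2) / (w * (bandBounds (show (-4 : ℝ) < -1.1 by norm_num) (show (-1.1 : ℝ) ≤ -0.1 by norm_num) (show (-0.1 : ℝ) < 0 by norm_num)).umin ^ 2))) *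
          ((4 + 2 * (3 / 2 : ℝ) + 1 / 2) * Real.sqrt (4 + 2 * (3 / 2 : ℝ) + 1 / 2) *
                ((1 + Real.log 2 + log⁺ ((1 + 4 * (2 * (K₂ * msD A₃ A₄ 1 ^ 2) +
                    w * (bandBounds (show (-4 : ℝ) < -1.1 by norm_num) (show (-1.1 : ℝ) ≤ -0.1 by norm_num) (show (-0.1 : ℝ) < 0 by norm_num)).umin ^ 2) / (w * (bandBounds (show (-4 : ℝ) < -1.1 by norm_num) (show (-1.1 : ℝ) ≤ -0.1 by norm_num) (show (-0.1 : ℝ) < 0 by norm_num)).umin ^ 2)) * (1 + (3 / 2 : ℝ))) + log⁺ (1 + 4 * (2 * (K₂ * msD A₃ A₄ 1 ^ 2) +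
                    w * (bandBounds (show (-4 : ℝ) < -1.1 by norm_num) (show (-1.1 : ℝ) ≤ -0.1 by norm_num) (show (-0.1 : ℝ) < 0 by norm_num)).umin ^ 2) / (w * (bandBounds (show (-4 : ℝ) < -1.1 by norm_num) (show (-1.1 : ℝ) ≤ -0.1 by norm_num) (show (-0.1 : ℝ) < 0 by norm_num)).umin ^ 2))) + 4) +
            2 * (1 + Real.log 2 + log⁺ ((1 + 4 * (2 * (K₂ * msD A₃ A₄ 1 ^ 2) +
                    w * (bandBounds (show (-4 : ℝ) < -1.1 by norm_num) (show (-1.1 : ℝ) ≤ -0.1 by norm_num) (show (-0.1 : ℝ) < 0 by norm_num)).umin ^ 2) / (w * (bandBounds (show (-4 : ℝ) < -1.1 by norm_num) (show (-1.1 : ℝ) ≤ -0.1 by norm_num) (show (-0.1 : ℝ) < 0 by norm_num)).umin ^ 2)) * (1 + (3 / 2 : ℝ))) + log⁺ (1 + 4 * (2 * (K₂ * msD A₃ A₄ 1 ^ 2) +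
                    w * (bandBounds (show (-4 : ℝ) < -1.1 by norm_num) (show (-1.1 : ℝ) ≤ -0.1 by norm_num) (show (-0.1 : ℝ) < 0 by norm_num)).umin ^ 2) / (w * (bandBounds (show (-4 : ℝ) < -1.1 by norm_num) (show (-1.1 : ℝ) ≤ -0.1 by norm_num) (show (-0.1 : ℝ) < 0 by norm_num)).umin ^ 2))) *
              ((4 + 2 * (3 / 2 : ℝ) + 1 / 2) / (1 / 2) * Real.sqrt ((4 + 2 * (3 / 2 : ℝ) + 1 / 2) / (1 / 2)))) *
        (Real.sqrt |sInf ((fun x : ℝ => frameLevel μ K (S - levelPoint μ K 0 (x + θ))) '' Icc α β)|)⁻¹) := by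
  have hhir' : -r < -hi := by linarith
  -- the four families of rows restricted to a positive floor `lo' > 0`, above and below the Fermi level
  have habs : ∀ {lo' e : ℝ}, 0 < lo' → e ∈ Icc lo' hi → |e| = e := fun hlo' he => abs_of_pos (hlo'.trans_le he.1)
  have hmem : ∀ {lo' e : ℝ}, 0 < lo' → e ∈ Icc lo' hi → e ∈ Icc (-hi) hi ∧ e ≠ 0 := fun hlo' he =>
    ⟨⟨by linarith [he.1], he.2⟩, (hlo'.trans_le he.1).ne'⟩
  have hmemn : ∀ {lo' s : ℝ}, 0 < lo' → s ∈ Icc lo' hi → -s ∈ Icc (-hi) hi ∧ -s ≠ 0 := fun hlo' hs =>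
    ⟨⟨by linarith [hs.2], by linarith [hs.1]⟩, by have := hlo'.trans_le hs.1; intro h; linarith⟩
  have habsn : ∀ {lo' s : ℝ}, 0 < lo' → s ∈ Icc lo' hi → |(-s)| = s := fun hlo' hs => by rw [abs_neg]; exact abs_of_pos (hlo'.trans_le hs.1)
  -- above the Fermi level, every floor
  have hpos : ∀ lo' ∈ Ioc 0 hi, ∫ e in lo'..hi, wt e * |∫ v in α..β, X e v * deriv (Kr e) (frameLevel μ K (S - levelPoint μ K e (v + θ)))| ≤ 
      W * (X₀ * (4 / Real.sqrt (2 * (K₂ * msD A₃ A₄ 1 ^ 2) +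
                    w * (bandBounds (show (-4 : ℝ) < -1.1 by norm_num) (show (-1.1 : ℝ) ≤ -0.1 by norm_num) (show (-0.1 : ℝ) < 0 by norm_num)).umin ^ 2) + 16 * Real.sqrt (2 * (K₂ * msD A₃ A₄ 1 ^ 2) +
                    w * (bandBounds (show (-4 : ℝ) < -1.1 by norm_num) (show (-1.1 : ℝ) ≤ -0.1 by norm_num) (show (-0.1 : ℝ) < 0 by norm_num)).umin ^ 2) / (w * (bandBounds (show (-4 : ℝ) < -1.1 by norm_num) (show (-1.1 : ℝ) ≤ -0.1 by norm_num) (show (-0.1 : ℝ) < 0 by norm_num)).umin ^ 2) + 64 * (2 * (K₂ * msD A₃ A₄ 1 ^ 2) +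
                    w * (bandBounds (show (-4 : ℝ) < -1.1 by norm_num) (show (-1.1 : ℝ) ≤ -0.1 by norm_num) (show (-0.1 : ℝ) < 0 by norm_num)).umin ^ 2) ^ 2 * Real.sqrt (2 * (K₂ * msD A₃ A₄ 1 ^ 2) +
                    w * (bandBounds (show (-4 : ℝ) < -1.1 by norm_num) (show (-1.1 : ℝ) ≤ -0.1 by norm_num) (show (-0.1 : ℝ) < 0 by norm_num)).umin ^ 2) / (w * (bandBounds (show (-4 : ℝ) < -1.1 by norm_num) (show (-1.1 : ℝ) ≤ -0.1 by norm_num) (show (-0.1 : ℝ) < 0 by norm_num)).umin ^ 2) ^ 3 +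
              2 * Real.sqrt (w * (bandBounds (show (-4 : ℝ) < -1.1 by norm_num) (show (-1.1 : ℝ) ≤ -0.1 by norm_num) (show (-0.1 : ℝ) < 0 by norm_num)).umin ^ 2) / (w * (bandBounds (show (-4 : ℝ) < -1.1 by norm_num) (show (-1.1 : ℝ) ≤ -0.1 by norm_num) (show (-0.1 : ℝ) < 0 by norm_num)).umin ^ 2) + (2 * (K₂ * msD A₃ A₄ 1 ^ 2) +
                    w * (bandBounds (show (-4 : ℝ) < -1.1 by norm_num) (show (-1.1 : ℝ) ≤ -0.1 by norm_num) (show (-0.1 : ℝ) < 0 by norm_num)).umin ^ 2) * Real.sqrt (w * (bandBounds (show (-4 : ℝ) < -1.1 by norm_num) (show (-1.1 : ℝ) ≤ -0.1 by norm_num) (show (-0.1 : ℝ) < 0 by norm_num)).umin ^ 2) / (w * (bandBounds (show (-4 : ℝ) < -1.1 by norm_num) (show (-1.1 : ℝ) ≤ -0.1 by norm_num) (show (-0.1 : ℝ) < 0 by norm_num)).umin ^ 2) ^ 2) +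
            X₁ * (32 * (2 * (K₂ * msD A₃ A₄ 1 ^ 2) +
                    w * (bandBounds (show (-4 : ℝ) < -1.1 by norm_num) (show (-1.1 : ℝ) ≤ -0.1 by norm_num) (show (-0.1 : ℝ) < 0 by norm_num)).umin ^ 2) * Real.sqrt (K₀ + hi) / (w * (bandBounds (show (-4 : ℝ) < -1.1 by norm_num) (show (-1.1 : ℝ) ≤ -0.1 by norm_num) (show (-0.1 : ℝ) < 0 by norm_num)).umin ^ 2) ^ 2 + (β - α) * Real.sqrt (w * (bandBounds (show (-4 : ℝ) < -1.1 by norm_num) (show (-1.1 : ℝ) ≤ -0.1 by norm_num) (show (-0.1 : ℝ) < 0 by norm_num)).umin ^ 2) / (w * (bandBounds (show (-4 : ℝ) < -1.1 by norm_num) (show (-1.1 : ℝ) ≤ -0.1 by norm_num) (show (-0.1 : ℝ) < 0 by norm_num)).umin ^ 2))) *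
          ((4 + 2 * (3 / 2 : ℝ) + 1 / 2) * Real.sqrt (4 + 2 * (3 / 2 : ℝ) + 1 / 2) *
                ((1 + Real.log 2 + log⁺ ((1 + 4 * (2 * (K₂ * msD A₃ A₄ 1 ^ 2) +
                    w * (bandBounds (show (-4 : ℝ) < -1.1 by norm_num) (show (-1.1 : ℝ) ≤ -0.1 by norm_num) (show (-0.1 : ℝ) < 0 by norm_num)).umin ^ 2) / (w * (bandBounds (show (-4 : ℝ) < -1.1 by norm_num) (show (-1.1 : ℝ) ≤ -0.1 by norm_num) (show (-0.1 : ℝ) < 0 by norm_num)).umin ^ 2)) * (1 + (3 / 2 : ℝ))) + log⁺ (1 + 4 * (2 * (K₂ * msD A₃ A₄ 1 ^ 2) +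
                    w * (bandBounds (show (-4 : ℝ) < -1.1 by norm_num) (show (-1.1 : ℝ) ≤ -0.1 by norm_num) (show (-0.1 : ℝ) < 0 by norm_num)).umin ^ 2) / (w * (bandBounds (show (-4 : ℝ) < -1.1 by norm_num) (show (-1.1 : ℝ) ≤ -0.1 by norm_num) (show (-0.1 : ℝ) < 0 by norm_num)).umin ^ 2))) + 4) +
            2 * (1 + Real.log 2 + log⁺ ((1 + 4 * (2 * (K₂ * msD A₃ A₄ 1 ^ 2) +
                    w * (bandBounds (show (-4 : ℝ) < -1.1 by norm_num) (show (-1.1 : ℝ) ≤ -0.1 by norm_num) (show (-0.1 : ℝ) < 0 by norm_num)).umin ^ 2) / (w * (bandBounds (show (-4 : ℝ) < -1.1 by norm_num) (show (-1.1 : ℝ) ≤ -0.1 by norm_num) (show (-0.1 : ℝ) < 0 by norm_num)).umin ^ 2)) * (1 + (3 / 2 : ℝ))) + log⁺ (1 + 4 * (2 * (K₂ * msD A₃ A₄ 1 ^ 2) +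
                    w * (bandBounds (show (-4 : ℝ) < -1.1 by norm_num) (show (-1.1 : ℝ) ≤ -0.1 by norm_num) (show (-0.1 : ℝ) < 0 by norm_num)).umin ^ 2) / (w * (bandBounds (show (-4 : ℝ) < -1.1 by norm_num) (show (-1.1 : ℝ) ≤ -0.1 by norm_num) (show (-0.1 : ℝ) < 0 by norm_num)).umin ^ 2))) *
              ((4 + 2 * (3 / 2 : ℝ) + 1 / 2) / (1 / 2) * Real.sqrt ((4 + 2 * (3 / 2 : ℝ) + 1 / 2) / (1 / 2)))) *
        (Real.sqrt |sInf ((fun x : ℝ => frameLevel μ K (S - levelPoint μ K 0 (x + θ))) '' Icc α β)|)⁻¹ := by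
    intro lo' hlo'
    exact intervalIntegral_partnerBand_post_le hA hA20 hd hr hlo hhi hA₃ hA₄ hK₁ hK₂ hK₃ hG S m θ hx₀ hWα hWβ hWφ hlo'.1 hlo'.2 hhir hK₀ hK₀pos hX₀ hX₁ hW  hδ₀
      hwin hslope hrate
      (fun e he => hK e (hmem hlo'.1 he).1 (hmem hlo'.1 he).2)
      (fun e he u => by have h := hK0 e (hmem hlo'.1 he).1 (hmem hlo'.1 he).2 u; rwa [habs hlo'.1 he] at h)
      (fun e he u => by have h := hK1 e (hmem hlo'.1 he).1 (hmem hlo'.1 he).2 u; rwa [habs hlo'.1 he] at h)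
      (fun e he => hX e (hmem hlo'.1 he).1) (fun e he v hv => hXb e (hmem hlo'.1 he).1 v hv) (fun e he v hv => hX₁b e (hmem hlo'.1 he).1 v hv)
      (fun e he => hXα e (hmem hlo'.1 he).1) (fun e he => hXβ e (hmem hlo'.1 he).1) (fun e he => hw0 e (hmem hlo'.1 he).1) (fun e he => hw e (hmem hlo'.1 he).1)
  -- below the Fermi level, every floor (the reflected families)
  have hneg : ∀ lo' ∈ Ioc 0 hi, ∫ s in lo'..hi, wt (-s) * |∫ v in α..β, X (-s) v * deriv (Kr (-s)) (frameLevel μ K (S - levelPoint μ K (-s) (v + θ)))| ≤ 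
      W * (X₀ * (4 / Real.sqrt (2 * (K₂ * msD A₃ A₄ 1 ^ 2) +
                    w * (bandBounds (show (-4 : ℝ) < -1.1 by norm_num) (show (-1.1 : ℝ) ≤ -0.1 by norm_num) (show (-0.1 : ℝ) < 0 by norm_num)).umin ^ 2) + 16 * Real.sqrt (2 * (K₂ * msD A₃ A₄ 1 ^ 2) +
                    w * (bandBounds (show (-4 : ℝ) < -1.1 by norm_num) (show (-1.1 : ℝ) ≤ -0.1 by norm_num) (show (-0.1 : ℝ) < 0 by norm_num)).umin ^ 2) / (w * (bandBounds (show (-4 : ℝ) < -1.1 by norm_num) (show (-1.1 : ℝ) ≤ -0.1 by norm_num) (show (-0.1 : ℝ) < 0 by norm_num)).umin ^ 2) + 64 * (2 * (K₂ * msD A₃ A₄ 1 ^ 2) +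
                    w * (bandBounds (show (-4 : ℝ) < -1.1 by norm_num) (show (-1.1 : ℝ) ≤ -0.1 by norm_num) (show (-0.1 : ℝ) < 0 by norm_num)).umin ^ 2) ^ 2 * Real.sqrt (2 * (K₂ * msD A₃ A₄ 1 ^ 2) +
                    w * (bandBounds (show (-4 : ℝ) < -1.1 by norm_num) (show (-1.1 : ℝ) ≤ -0.1 by norm_num) (show (-0.1 : ℝ) < 0 by norm_num)).umin ^ 2) / (w * (bandBounds (show (-4 : ℝ) < -1.1 by norm_num) (show (-1.1 : ℝ) ≤ -0.1 by norm_num) (show (-0.1 : ℝ) < 0 by norm_num)).umin ^ 2) ^ 3 +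
              2 * Real.sqrt (w * (bandBounds (show (-4 : ℝ) < -1.1 by norm_num) (show (-1.1 : ℝ) ≤ -0.1 by norm_num) (show (-0.1 : ℝ) < 0 by norm_num)).umin ^ 2) / (w * (bandBounds (show (-4 : ℝ) < -1.1 by norm_num) (show (-1.1 : ℝ) ≤ -0.1 by norm_num) (show (-0.1 : ℝ) < 0 by norm_num)).umin ^ 2) + (2 * (K₂ * msD A₃ A₄ 1 ^ 2) +
                    w * (bandBounds (show (-4 : ℝ) < -1.1 by norm_num) (show (-1.1 : ℝ) ≤ -0.1 by norm_num) (show (-0.1 : ℝ) < 0 by norm_num)).umin ^ 2) * Real.sqrt (w * (bandBounds (show (-4 : ℝ) < -1.1 by norm_num) (show (-1.1 : ℝ) ≤ -0.1 by norm_num) (show (-0.1 : ℝ) < 0 by norm_num)).umin ^ 2) / (w * (bandBounds (show (-4 : ℝ) < -1.1 by norm_num) (show (-1.1 : ℝ) ≤ -0.1 by norm_num) (show (-0.1 : ℝ) < 0 by norm_num)).umin ^ 2) ^ 2) +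
            X₁ * (32 * (2 * (K₂ * msD A₃ A₄ 1 ^ 2) +
                    w * (bandBounds (show (-4 : ℝ) < -1.1 by norm_num) (show (-1.1 : ℝ) ≤ -0.1 by norm_num) (show (-0.1 : ℝ) < 0 by norm_num)).umin ^ 2) * Real.sqrt (K₀ + hi) / (w * (bandBounds (show (-4 : ℝ) < -1.1 by norm_num) (show (-1.1 : ℝ) ≤ -0.1 by norm_num) (show (-0.1 : ℝ) < 0 by norm_num)).umin ^ 2) ^ 2 + (β - α) * Real.sqrt (w * (bandBounds (show (-4 : ℝ) < -1.1 by norm_num) (show (-1.1 : ℝ) ≤ -0.1 by norm_num) (show (-0.1 : ℝ) < 0 by norm_num)).umin ^ 2) / (w * (bandBounds (show (-4 : ℝ) < -1.1 by norm_num) (show (-1.1 : ℝ) ≤ -0.1 by norm_num) (show (-0.1 : ℝ) < 0 by norm_num)).umin ^ 2))) *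
          ((4 + 2 * (3 / 2 : ℝ) + 1 / 2) * Real.sqrt (4 + 2 * (3 / 2 : ℝ) + 1 / 2) *
                ((1 + Real.log 2 + log⁺ ((1 + 4 * (2 * (K₂ * msD A₃ A₄ 1 ^ 2) +
                    w * (bandBounds (show (-4 : ℝ) < -1.1 by norm_num) (show (-1.1 : ℝ) ≤ -0.1 by norm_num) (show (-0.1 : ℝ) < 0 by norm_num)).umin ^ 2) / (w * (bandBounds (show (-4 : ℝ) < -1.1 by norm_num) (show (-1.1 : ℝ) ≤ -0.1 by norm_num) (show (-0.1 : ℝ) < 0 by norm_num)).umin ^ 2)) * (1 + (3 / 2 : ℝ))) + log⁺ (1 + 4 * (2 * (K₂ * msD A₃ A₄ 1 ^ 2) +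
                    w * (bandBounds (show (-4 : ℝ) < -1.1 by norm_num) (show (-1.1 : ℝ) ≤ -0.1 by norm_num) (show (-0.1 : ℝ) < 0 by norm_num)).umin ^ 2) / (w * (bandBounds (show (-4 : ℝ) < -1.1 by norm_num) (show (-1.1 : ℝ) ≤ -0.1 by norm_num) (show (-0.1 : ℝ) < 0 by norm_num)).umin ^ 2))) + 4) +
            2 * (1 + Real.log 2 + log⁺ ((1 + 4 * (2 * (K₂ * msD A₃ A₄ 1 ^ 2) +
                    w * (bandBounds (show (-4 : ℝ) < -1.1 by norm_num) (show (-1.1 : ℝ) ≤ -0.1 by norm_num) (show (-0.1 : ℝ) < 0 by norm_num)).umin ^ 2) / (w * (bandBounds (show (-4 : ℝ) < -1.1 by norm_num) (show (-1.1 : ℝ) ≤ -0.1 by norm_num) (show (-0.1 : ℝ) < 0 by norm_num)).umin ^ 2)) * (1 + (3 / 2 : ℝ))) + log⁺ (1 + 4 * (2 * (K₂ * msD A₃ A₄ 1 ^ 2) +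
                    w * (bandBounds (show (-4 : ℝ) < -1.1 by norm_num) (show (-1.1 : ℝ) ≤ -0.1 by norm_num) (show (-0.1 : ℝ) < 0 by norm_num)).umin ^ 2) / (w * (bandBounds (show (-4 : ℝ) < -1.1 by norm_num) (show (-1.1 : ℝ) ≤ -0.1 by norm_num) (show (-0.1 : ℝ) < 0 by norm_num)).umin ^ 2))) *
              ((4 + 2 * (3 / 2 : ℝ) + 1 / 2) / (1 / 2) * Real.sqrt ((4 + 2 * (3 / 2 : ℝ) + 1 / 2) / (1 / 2)))) *
        (Real.sqrt |sInf ((fun x : ℝ => frameLevel μ K (S - levelPoint μ K 0 (x + θ))) '' Icc α β)|)⁻¹ := by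
    intro lo' hlo'
    exact intervalIntegral_partnerBand_post_below_le hA hA20 hd hr hlo hhi hA₃ hA₄ hK₁ hK₂ hK₃ hG S m θ (X := fun s => X (-s)) (Kr := fun s => Kr (-s)) (wt := fun s => wt (-s))
      hx₀ hWα hWβ hWφ hlo'.1 hlo'.2 hhir hK₀ hK₀pos hX₀ hX₁ hW  hδ₀
      hwin hslope hrate
      (fun s hs => hK (-s) (hmemn hlo'.1 hs).1 (hmemn hlo'.1 hs).2)
      (fun s hs u => by have h := hK0 (-s) (hmemn hlo'.1 hs).1 (hmemn hlo'.1 hs).2 u; rwa [habsn hlo'.1 hs] at h)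
      (fun s hs u => by have h := hK1 (-s) (hmemn hlo'.1 hs).1 (hmemn hlo'.1 hs).2 u; rwa [habsn hlo'.1 hs] at h)
      (fun s hs => hX (-s) (hmemn hlo'.1 hs).1) (fun s hs v hv => hXb (-s) (hmemn hlo'.1 hs).1 v hv) (fun s hs v hv => hX₁b (-s) (hmemn hlo'.1 hs).1 v hv)
      (fun s hs => hXα (-s) (hmemn hlo'.1 hs).1) (fun s hs => hXβ (-s) (hmemn hlo'.1 hs).1) (fun s hs => hw0 (-s) (hmemn hlo'.1 hs).1)
      (fun s hs => hw (-s) (hmemn hlo'.1 hs).1)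
  -- pass to the Fermi level on both sides
  have hgiP : IntervalIntegrable (fun e => wt e * |∫ v in α..β, X e v * deriv (Kr e) (frameLevel μ K (S - levelPoint μ K e (v + θ)))|) volume 0 hi :=
    hgi.mono_set (by rw [uIcc_of_le (by linarith : -hi ≤ hi), uIcc_of_le hhi0.le]; exact Icc_subset_Icc (by linarith) le_rfl)
  have hgiN : IntervalIntegrable (fun e => wt e * |∫ v in α..β, X e v * deriv (Kr e) (frameLevel μ K (S - levelPoint μ K e (v + θ)))|) volume (-hi) 0 :=
    hgi.mono_set (by rw [uIcc_of_le (by linarith : -hi ≤ hi), uIcc_of_le (by linarith : -hi ≤ 0)]; exact Icc_subset_Icc le_rfl hhi0.le)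
  have hgiNr : IntervalIntegrable (fun s => wt (-s) * |∫ v in α..β, X (-s) v * deriv (Kr (-s)) (frameLevel μ K (S - levelPoint μ K (-s) (v + θ)))|) volume 0 hi := by
    have h := hgiN.comp_sub_left 0
    simp only [zero_sub, sub_zero, neg_neg] at h
    exact h.symm
  have hfwd := intervalIntegral_le_of_forall_Ioc_left hhi0 le_rfl hgiP hpos
  have hbwd := intervalIntegral_le_of_forall_Ioc_left hhi0 le_rfl hgiNr hneg
  have hsplit : ∫ e in (-hi)..hi, wt e * |∫ v in α..β, X e v * deriv (Kr e) (frameLevel μ K (S - levelPoint μ K e (v + θ)))| =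
      (∫ s in (0:ℝ)..hi, wt (-s) * |∫ v in α..β, X (-s) v * deriv (Kr (-s)) (frameLevel μ K (S - levelPoint μ K (-s) (v + θ)))|) +
        ∫ e in (0:ℝ)..hi, wt e * |∫ v in α..β, X e v * deriv (Kr e) (frameLevel μ K (S - levelPoint μ K e (v + θ)))| := by
    rw [← intervalIntegral.integral_add_adjacent_intervals hgiN hgiP]
    rw [intervalIntegral.integral_comp_neg (fun e => wt e * |∫ v in α..β, X e v * deriv (Kr e) (frameLevel μ K (S - levelPoint μ K e (v + θ)))|)]
    simp
  rw [hsplit]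
  linarith

end Sizes

end Summit.HubbardSuperconductivity.HubbardSuperconductivity.Theorems.C4a

end
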